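import Mathlib
import HarnessLib
import Summits.HubbardSuperconductivity.HubbardSuperconductivity.Theorems.KLProgrammeKLRegimeFlowReadScaleZeroChainOnCurve
import Summits.HubbardSuperconductivity.HubbardSuperconductivity.Theorems.KLProgrammeKLRegimeFlowReadScaleZeroVanishingSymbolCurveJets
import Summits.HubbardSuperconductivity.HubbardSuperconductivity.Theorems.KLProgrammeKLRegimeEngineScaleZeroE4Bands
import Summits.HubbardSuperconductivity.HubbardSuperconductivity.Theorems.KLProgrammeKLRegimeEngineFrameShiftDressingSymbols
import Summits.HubbardSuperconductivity.HubbardSuperconductivity.Theorems.KLProgrammeC4aLatticeTubeSum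
import Summits.HubbardSuperconductivity.HubbardSuperconductivity.Theorems.KLProgrammeH10TwoPointLimitFrameFermiPoint
import Literature.MathematicalPhysics.QuantumLattice.HubbardSliceSymbolJetsGevrey
import Literature.MathematicalPhysics.QuantumLattice.SalmhoferCutoffGevrey

/-!
# Route `KLProgramme`, crux K3 — gen-8 ENGINE-FLOW child (stmt-HubbardSuperconductivity-20437 `KLRegimeEngineV17F2`), stub (C) at `n = 0`,
# located item #22a «(C)-SCALE0-PT2», step (π2c-iii): THE HARTREE CHAIN'S READING ON THE FREE FERMI CURVE IS PURE ALIASING — value and angular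
# jets `k ≤ 4` of `H∘γ₀`, `H = evalM (symInterp L (loc(map S_{4M} Q_c)))`, bounded by `bell4 A D k` with EXPLICIT Gevrey alias constants

Seat hubbard-kl-k3c5-p1 (g13; owner of #22a).  The `W_b`-hypotheses `hHval` / `hHτ` / `hHjet` of the MIXED door (p608958
`…FlowReadScaleZeroMixed.twoLegRead_frameZero_of_split_certD`) for the chain piece `W_b := Q_c` of the split `W₀ = (W₀ − Q_c) + Q_c` (π2b, p613532).
By π2c-i (p614131) the localised symbol of `map S Q_c` is the lattice sample `F_κ∘p` of the continuum symbol
  `F_κ(q) = ½[Re(κ·Ψ̂_ξ(π/β, e₀(q))) + Re(κ·Ψ̂_ξ(−π/β, e₀(q)))]`,  `κ = −c(4M)²/(β³L²)`,  `e₀ = frameLevel μ 0`,  `Ψ̂_ξ = uvSymbolFnXi (βL²) klE0`,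
which is smooth, `2π`-periodic, `D₄`-symmetric, has Gevrey-2 top jets `‖D^M F_κ‖ ≤ ‖κ‖·B_M`, `B_M = 8·(|βL²|·2/Λ₀)·(M!)²·(16(1 + 2·16·343/Λ₀))^M`
(`Literature.….norm_iteratedFDeriv_uvSymbol_comp_le_gevrey_band` with the cutoff table `X₀ = 8`, `C_χ = 342` and the free band's jets `‖Dⁱe₀‖ ≤ 4 ≤ i!4ⁱ`),
and VANISHES on the free Fermi curve (`e₀∘γ₀ = 0`, `Ψ̂(0,ω)+Ψ̂(0,−ω) = 0`).  Hence π2c-ii (p615086 `abs_curveJets_evalM_symInterp_le_bell4_of_vanish`)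
applies: for every `M ≥ 8` and majorants `A j ≥ 2·3ʲ·‖κ‖B_M·(2/N)^{M−j−4}·4C₂` (`j ≤ 4`, `N = 2(L/4+1)`),
  `|H(γ₀θ)| ≤ A 0`,  `|(H∘γ₀)^{(k)}(θ)| ≤ bell4 A D k`  (`1 ≤ k ≤ 4`)
— the shapes `hHval` (with `hv := 0`), `hHτ` (with `τ := 0`) and `hHjet` of the door, once the assembly writes `A 0 = h0·U²`, `bell4 A D k = s_k·U²`
(`κ ∝ U²` through `c = (Uβ/4M)²t₀²`).

* §1 `chainSymbolFn_periodic/_reflect/_swap/contDiff` — the four structural facts of `F_κ`;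
* §2 `norm_iteratedFDeriv_re_const_mul_le`, **`norm_iteratedFDeriv_chainSymbolFn_le`** — `‖D^M F_κ(q)‖ ≤ ‖κ‖·B_M`;
* §3 `frameLevel_zero_klFermiPoint_zero`, `chainSymbolFn_klFermiPoint` — `F_κ∘γ₀ ≡ 0` on the window;
* §4 `locSymbol_map_gridSub_chainQuadratic_eq_sample` — the door's data function IS `F_κ∘p`;
* §5 **`chain_readJets_frameZero_le_bell4`** — the statement of the title.

Proofs only; no definitions; nothing asserts any stub of 20437, K3 or superconductivity.
References: BGM 2006 §2.1 (2.3), §2.3 (2.17), (2.36aa) [cite: BenfattoGiulianiMastropietro2006]; Salmhofer 1999 §4.2.5 (4.70) [cite: Salmhofer1999].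
-/

noncomputable section

namespace Summit.HubbardSuperconductivity.HubbardSuperconductivity.Theorems.EngineV8

set_option linter.dupNamespace false -- summit = problem name (single-conjunct summit), D-0017

open Real Set Finset Literature.MathematicalPhysics.QuantumLattice Literature.Probability.LatticeModels GrassmannAlgebra Matrix
open Literature.MathematicalPhysics.QuantumLattice.BandSectorCounting
open Summit.HubbardSuperconductivity.HubbardSuperconductivity.Theorems.KLRegimeSplit
open Summit.HubbardSuperconductivity.HubbardSuperconductivity.Theorems.C4a
open Summit.HubbardSuperconductivity.HubbardSuperconductivity.Theorems.DispersionFlow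
open Summit.HubbardSuperconductivity.HubbardSuperconductivity.Theorems.PerturbedFermiCurve
open scoped Nat

variable {L M : ℕ}

/-! ## §1 Structure of the chain's continuum symbol `F_κ` -/

/-- `F_κ` is `2π`-periodic in each momentum coordinate (the band is). -/
theorem chainSymbolFn_periodic (κ : ℂ) (cc Λ ω₁ ω₂ μ : ℝ) (j : Fin 2) (q : Momentum) :
    (fun q : Momentum => ((κ * uvSymbolFnXi cc Λ ω₁ (frameLevel μ 0 q)).re + (κ * uvSymbolFnXi cc Λ ω₂ (frameLevel μ 0 q)).re) / 2)
        (q + EuclideanSpace.single j (2 * π)) =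
      (fun q : Momentum => ((κ * uvSymbolFnXi cc Λ ω₁ (frameLevel μ 0 q)).re + (κ * uvSymbolFnXi cc Λ ω₂ (frameLevel μ 0 q)).re) / 2) q := by
  simp only [frameLevel_periodic_single]

/-- `F_κ` is reflection-symmetric. -/
theorem chainSymbolFn_reflect (κ : ℂ) (cc Λ ω₁ ω₂ μ : ℝ) (p : Fin 2 → ℝ) :
    (fun q : Momentum => ((κ * uvSymbolFnXi cc Λ ω₁ (frameLevel μ 0 q)).re + (κ * uvSymbolFnXi cc Λ ω₂ (frameLevel μ 0 q)).re) / 2)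
        (WithLp.toLp 2 ![p 0, -p 1]) =
      (fun q : Momentum => ((κ * uvSymbolFnXi cc Λ ω₁ (frameLevel μ 0 q)).re + (κ * uvSymbolFnXi cc Λ ω₂ (frameLevel μ 0 q)).re) / 2)
        (WithLp.toLp 2 p) := by
  simp only [frameLevel_toLp_reflect]

/-- `F_κ` is swap-symmetric. -/
theorem chainSymbolFn_swap (κ : ℂ) (cc Λ ω₁ ω₂ μ : ℝ) (p : Fin 2 → ℝ) :
    (fun q : Momentum => ((κ * uvSymbolFnXi cc Λ ω₁ (frameLevel μ 0 q)).re + (κ * uvSymbolFnXi cc Λ ω₂ (frameLevel μ 0 q)).re) / 2)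
        (WithLp.toLp 2 ![p 1, p 0]) =
      (fun q : Momentum => ((κ * uvSymbolFnXi cc Λ ω₁ (frameLevel μ 0 q)).re + (κ * uvSymbolFnXi cc Λ ω₂ (frameLevel μ 0 q)).re) / 2)
        (WithLp.toLp 2 p) := by
  simp only [frameLevel_toLp_swap]

/-- One summand `q ↦ Re(κ·Ψ̂_ξ(ω, e₀(q)))` is smooth (`ω ≠ 0`). -/
theorem contDiff_re_const_mul_uvSymbolFnXi_frameLevel (κ : ℂ) (cc Λ : ℝ) {ω : ℝ} (hω : ω ≠ 0) (μ : ℝ) {n : ℕ∞} :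
    ContDiff ℝ n (fun q : Momentum => (κ * uvSymbolFnXi cc Λ ω (frameLevel μ 0 q)).re) := by
  have h1 : ContDiff ℝ n (fun q : Momentum => uvSymbolFnXi cc Λ ω (frameLevel μ 0 q)) :=
    (contDiff_uvSymbolFnXi (c := cc) (Λ := Λ) hω).comp (contDiff_frameLevel μ 0)
  exact Complex.reCLM.contDiff.comp (contDiff_const.mul h1)

/-- `F_κ` is smooth (`ω₁, ω₂ ≠ 0`). -/
theorem contDiff_chainSymbolFn (κ : ℂ) (cc Λ : ℝ) {ω₁ ω₂ : ℝ} (hω₁ : ω₁ ≠ 0) (hω₂ : ω₂ ≠ 0) (μ : ℝ) {n : ℕ∞} :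
    ContDiff ℝ n (fun q : Momentum =>
      ((κ * uvSymbolFnXi cc Λ ω₁ (frameLevel μ 0 q)).re + (κ * uvSymbolFnXi cc Λ ω₂ (frameLevel μ 0 q)).re) / 2) :=
  ((contDiff_re_const_mul_uvSymbolFnXi_frameLevel κ cc Λ hω₁ μ).add
    (contDiff_re_const_mul_uvSymbolFnXi_frameLevel κ cc Λ hω₂ μ)).div_const 2

/-! ## §2 Gevrey top jets of `F_κ` -/

/-- `‖Dⁿ[q ↦ Re(κ·Φ(q))](q)‖ ≤ ‖κ‖·B` when `‖DⁿΦ(q)‖ ≤ B` (`Φ` smooth, complex-valued). -/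
theorem norm_iteratedFDeriv_re_const_mul_le {Φ : Momentum → ℂ} (hΦ : ContDiff ℝ (⊤ : ℕ∞) Φ) (κ : ℂ) {n : ℕ} {B : ℝ} (q : Momentum)
    (hB : ‖iteratedFDeriv ℝ n Φ q‖ ≤ B) : ‖iteratedFDeriv ℝ n (fun q : Momentum => (κ * Φ q).re) q‖ ≤ ‖κ‖ * B := by
  have hκΦ : ContDiff ℝ (⊤ : ℕ∞) (fun q : Momentum => κ * Φ q) := contDiff_const.mul hΦ
  have hfun : (fun q : Momentum => (κ * Φ q).re) = Complex.reCLM ∘ fun q : Momentum => κ * Φ q := rfl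
  rw [hfun]
  refine (ContinuousLinearMap.norm_iteratedFDeriv_comp_left Complex.reCLM hκΦ.contDiffAt (by exact_mod_cast le_top)).trans ?_
  rw [Complex.reCLM_norm, one_mul]
  have hsmul : (fun q : Momentum => κ * Φ q) = fun q : Momentum => κ • Φ q := rfl
  rw [hsmul, iteratedFDeriv_const_smul_apply' (hΦ.of_le (by exact_mod_cast le_top)).contDiffAt, norm_smul]
  exact mul_le_mul_of_nonneg_left hB (norm_nonneg _)

/-- **Gevrey top jets of one summand**: `‖Dⁿ[q ↦ Ψ̂_ξ(ω, e₀(q))](q)‖ ≤ 8·(|cc|·2/Λ₀)·(n!)²·(16(1 + 2·16·343/Λ₀))ⁿ` (`Λ₀ = klE0`, `ω ≠ 0`). -/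
theorem norm_iteratedFDeriv_uvSymbolFnXi_frameLevel_zero_le (cc : ℝ) {ω : ℝ} (hω : ω ≠ 0) (μ : ℝ) (n : ℕ) (q : Momentum) :
    ‖iteratedFDeriv ℝ n (fun q : Momentum => uvSymbolFnXi cc klE0 ω (frameLevel μ 0 q)) q‖ ≤
      8 * (|cc| * (2 / klE0)) * ((n ! : ℝ)) ^ 2 * (4 * 4 * (1 + 2 * (16 * (1 + 342) / klE0))) ^ n := by
  have hΛ : (0 : ℝ) < klE0 := by norm_num [klE0]
  refine norm_iteratedFDeriv_uvSymbol_comp_le_gevrey_band (c := cc) (E := Momentum) hΛ hω (X₀ := 8) (Cχ := 342) (by norm_num) (by norm_num)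
    (salmhoferCutoff_gevrey_table n) (contDiff_frameLevel μ 0) (Eu := 4) (by norm_num) q fun i hi _ => ?_
  refine (norm_iteratedFDeriv_frameLevel_zero_le μ hi q).trans ?_
  have h1 : (1 : ℝ) ≤ (i ! : ℝ) := by exact_mod_cast Nat.one_le_iff_ne_zero.mpr (Nat.factorial_ne_zero i)
  have h2 : (4 : ℝ) ≤ 4 ^ i := by
    calc (4 : ℝ) = 4 ^ 1 := (pow_one _).symm
      _ ≤ 4 ^ i := pow_le_pow_right₀ (by norm_num) hi
  nlinarith

/-- **GEVREY TOP JETS OF THE CHAIN'S CONTINUUM SYMBOL**: `‖Dⁿ F_κ(q)‖ ≤ ‖κ‖·8·(|cc|·2/Λ₀)·(n!)²·(16(1 + 2·16·343/Λ₀))ⁿ` at every `q` (`ω₁, ω₂ ≠ 0`). -/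
theorem norm_iteratedFDeriv_chainSymbolFn_le (κ : ℂ) (cc : ℝ) {ω₁ ω₂ : ℝ} (hω₁ : ω₁ ≠ 0) (hω₂ : ω₂ ≠ 0) (μ : ℝ) (n : ℕ) (q : Momentum) :
    ‖iteratedFDeriv ℝ n (fun q : Momentum =>
        ((κ * uvSymbolFnXi cc klE0 ω₁ (frameLevel μ 0 q)).re + (κ * uvSymbolFnXi cc klE0 ω₂ (frameLevel μ 0 q)).re) / 2) q‖ ≤
      ‖κ‖ * (8 * (|cc| * (2 / klE0)) * ((n ! : ℝ)) ^ 2 * (4 * 4 * (1 + 2 * (16 * (1 + 342) / klE0))) ^ n) := by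
  have hg₁ : ContDiff ℝ (⊤ : ℕ∞) (fun q : Momentum => (κ * uvSymbolFnXi cc klE0 ω₁ (frameLevel μ 0 q)).re) :=
    contDiff_re_const_mul_uvSymbolFnXi_frameLevel κ cc klE0 hω₁ μ
  have hg₂ : ContDiff ℝ (⊤ : ℕ∞) (fun q : Momentum => (κ * uvSymbolFnXi cc klE0 ω₂ (frameLevel μ 0 q)).re) :=
    contDiff_re_const_mul_uvSymbolFnXi_frameLevel κ cc klE0 hω₂ μ
  have hΦ₁ : ContDiff ℝ (⊤ : ℕ∞) (fun q : Momentum => uvSymbolFnXi cc klE0 ω₁ (frameLevel μ 0 q)) :=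
    (contDiff_uvSymbolFnXi (c := cc) (Λ := klE0) hω₁).comp (contDiff_frameLevel μ 0)
  have hΦ₂ : ContDiff ℝ (⊤ : ℕ∞) (fun q : Momentum => uvSymbolFnXi cc klE0 ω₂ (frameLevel μ 0 q)) :=
    (contDiff_uvSymbolFnXi (c := cc) (Λ := klE0) hω₂).comp (contDiff_frameLevel μ 0)
  have b₁ := norm_iteratedFDeriv_re_const_mul_le hΦ₁ κ q (norm_iteratedFDeriv_uvSymbolFnXi_frameLevel_zero_le cc hω₁ μ n q)
  have b₂ := norm_iteratedFDeriv_re_const_mul_le hΦ₂ κ q (norm_iteratedFDeriv_uvSymbolFnXi_frameLevel_zero_le cc hω₂ μ n q)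
  have hfun : (fun q : Momentum =>
      ((κ * uvSymbolFnXi cc klE0 ω₁ (frameLevel μ 0 q)).re + (κ * uvSymbolFnXi cc klE0 ω₂ (frameLevel μ 0 q)).re) / 2) =
      fun q : Momentum => (1 / 2 : ℝ) • ((fun q : Momentum => (κ * uvSymbolFnXi cc klE0 ω₁ (frameLevel μ 0 q)).re) +
        (fun q : Momentum => (κ * uvSymbolFnXi cc klE0 ω₂ (frameLevel μ 0 q)).re)) q := by
    funext q; simp only [Pi.add_apply, smul_eq_mul]; ring
  have hG : ContDiff ℝ n ((fun q : Momentum => (κ * uvSymbolFnXi cc klE0 ω₁ (frameLevel μ 0 q)).re) +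
      fun q : Momentum => (κ * uvSymbolFnXi cc klE0 ω₂ (frameLevel μ 0 q)).re) :=
    (hg₁.add hg₂).of_le (by exact_mod_cast le_top)
  rw [hfun, iteratedFDeriv_const_smul_apply' hG.contDiffAt,
    iteratedFDeriv_add_apply ((hg₁.of_le (by exact_mod_cast le_top)).contDiffAt) ((hg₂.of_le (by exact_mod_cast le_top)).contDiffAt),
    norm_smul, Real.norm_eq_abs, abs_of_pos (by norm_num : (0 : ℝ) < 1 / 2)]
  have := norm_add_le (iteratedFDeriv ℝ n (fun q : Momentum => (κ * uvSymbolFnXi cc klE0 ω₁ (frameLevel μ 0 q)).re) q)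
    (iteratedFDeriv ℝ n (fun q : Momentum => (κ * uvSymbolFnXi cc klE0 ω₂ (frameLevel μ 0 q)).re) q)
  nlinarith [norm_nonneg (iteratedFDeriv ℝ n (fun q : Momentum => (κ * uvSymbolFnXi cc klE0 ω₁ (frameLevel μ 0 q)).re) q +
    iteratedFDeriv ℝ n (fun q : Momentum => (κ * uvSymbolFnXi cc klE0 ω₂ (frameLevel μ 0 q)).re) q)]

/-! ## §3 `F_κ` vanishes on the free Fermi curve -/

/-- **On the window the free Fermi point lies on the free Fermi curve**: `e₀(γ₀θ) = frameLevel μ 0 (toLp (klFermiPoint μ 0 θ)) = 0` (`μ ∈ klWindowC`). -/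
theorem frameLevel_zero_klFermiPoint_zero {μ : ℝ} (hμ : μ ∈ klWindowC) (θ : ℝ) :
    frameLevel μ 0 (WithLp.toLp 2 (klFermiPoint μ 0 θ)) = 0 := by
  have hA : ∀ p : Momentum, ∀ j ≤ 2, ‖iteratedFDeriv ℝ j (frameShift (0 : TrigPolyC4v)) p‖ ≤ 0 := fun p j _ => by
    have hz : frameShift (0 : TrigPolyC4v) = fun _ : Momentum => (0 : ℝ) := by funext q; simp [frameShift]
    rw [hz, iteratedFDeriv_fun_zero]
    simp
  have h1 := hμ.1; have h2 := hμ.2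
  exact frameLevel_klFermiPoint (bandBounds (show (-4 : ℝ) < -1.1 by norm_num) (show (-1.1 : ℝ) ≤ -0.1 by norm_num)
    (show (-0.1 : ℝ) < 0 by norm_num)) hA (by norm_num [klWindowC] at h1 ⊢; linarith) (by norm_num [klWindowC] at h2 ⊢; linarith) θ

/-- **`F_κ∘γ₀ ≡ 0` on the window**: at the free Fermi point the band vanishes and the two frequencies `±π/β` cancel. -/
theorem chainSymbolFn_klFermiPoint (κ : ℂ) (cc β : ℝ) {μ : ℝ} (hμ : μ ∈ klWindowC) (θ : ℝ) :
    (fun q : Momentum => ((κ * uvSymbolFnXi cc klE0 (π / β) (frameLevel μ 0 q)).re +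
        (κ * uvSymbolFnXi cc klE0 (-(π / β)) (frameLevel μ 0 q)).re) / 2) (WithLp.toLp 2 (klFermiPoint μ 0 θ)) = 0 := by
  simp only [frameLevel_zero_klFermiPoint_zero hμ θ, ← uvSymbolFn_eq_uvSymbolFnXi]
  exact chainCurveFn_zero κ cc klE0 β

/-! ## §4 The door's data function for `W_b := Q_c` is the lattice sample of `F_κ` -/

/-- **The localised symbol of `map S_{4M} Q_c` is `F_κ∘p`** with `κ = −c(4M)²/(β³L²)` (`0 < β`): π2c-i's `locSymbol_map_gridSub_chainQuadratic` read through
`uvSymbolFn = uvSymbolFnXi` and `nambuXi L μ k⃗ = e₀(2πk⃗/L)`. -/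
theorem locSymbol_map_gridSub_chainQuadratic_eq_sample [NeZero L] [NeZero M] {β : ℝ} (hβ : 0 < β) (μ : ℝ) (c : ℂ) :
    (fun k : TorusSite 2 L => (∑ σ : Fin 2, ((selfEnergy L M β (ExteriorAlgebra.map (Matrix.toLin' (hubbardGridSub L M β (2 * (2 * M))))
        (∑ p : GridPoint L (2 * (2 * M)), ∑ q : GridPoint L (2 * (2 * M)), ∑ σ' : Fin 2,
          (c * contr ℂ ((hubbardGridSub L M β (2 * (2 * M))).transpose * hubbardCovAboveCT L M β μ 0 0 klE0 *
              hubbardGridSub L M β (2 * (2 * M))) (((q, σ'), 0) : GridLeg (GridPoint L (2 * (2 * M)))) ((p, σ'), 1)) •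
            (gen ℂ (((p, σ'), 0) : GridLeg (GridPoint L (2 * (2 * M)))) * gen ℂ (((q, σ'), 1) : GridLeg (GridPoint L (2 * (2 * M)))))))
          (omega0 M, k) σ).re +
      (selfEnergy L M β (ExteriorAlgebra.map (Matrix.toLin' (hubbardGridSub L M β (2 * (2 * M))))
        (∑ p : GridPoint L (2 * (2 * M)), ∑ q : GridPoint L (2 * (2 * M)), ∑ σ' : Fin 2,
          (c * contr ℂ ((hubbardGridSub L M β (2 * (2 * M))).transpose * hubbardCovAboveCT L M β μ 0 0 klE0 *
              hubbardGridSub L M β (2 * (2 * M))) (((q, σ'), 0) : GridLeg (GridPoint L (2 * (2 * M)))) ((p, σ'), 1)) •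
            (gen ℂ (((p, σ'), 0) : GridLeg (GridPoint L (2 * (2 * M)))) * gen ℂ (((q, σ'), 1) : GridLeg (GridPoint L (2 * (2 * M)))))))
          ((omega0 M).rev, k) σ).re)) / 4) =
      fun k : TorusSite 2 L => (fun q : Momentum =>
        (((-c * ((((2 * (2 * M) : ℕ) : ℂ) ^ 2 / (β ^ 3 * (L : ℝ) ^ 2 : ℝ)) : ℂ)) * uvSymbolFnXi (β * (L : ℝ) ^ 2) klE0 (π / β) (frameLevel μ 0 q)).re +
          ((-c * ((((2 * (2 * M) : ℕ) : ℂ) ^ 2 / (β ^ 3 * (L : ℝ) ^ 2 : ℝ)) : ℂ)) * uvSymbolFnXi (β * (L : ℝ) ^ 2) klE0 (-(π / β)) (frameLevel μ 0 q)).re) / 2)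
        (WithLp.toLp 2 (latticeMomentum L k)) := by
  funext k
  rw [locSymbol_map_gridSub_chainQuadratic hβ μ c k]
  simp only [uvSymbolFn_eq_uvSymbolFnXi, ← nambuXiCT_zero_frame, nambuXiCT_eq_frameLevel]

/-! ## §5 The chain's reading on the free Fermi curve -/

/-- **THE HARTREE CHAIN'S READING ON THE FREE FERMI CURVE IS PURE ALIASING.**  For `0 < β`, `μ ∈ klWindowC`, any chain coefficient `c`, any
order `Mdeg ≥ 8`, the free Fermi-point map `γ₀` of class `C⁴` with sizes `D i`, and majorants
`A j ≥ 2·3ʲ·(‖κ‖B_{Mdeg})·(2/N)^{Mdeg−j−4}·4C₂` (`j ≤ 4`; `κ = −c(4M)²/(β³L²)`, `B_M = 8(|βL²|·2/Λ₀)(M!)²(16(1+2·16·343/Λ₀))^M`, `N = 2(L/4+1)`):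
with `H = evalM (symInterp L (loc(map S_{4M} Q_c)))`, for every `θ`, `|H(γ₀θ)| ≤ A 0` and `|(H∘γ₀)^{(k)}(θ)| ≤ bell4 A D k` (`1 ≤ k ≤ 4`). -/
theorem chain_readJets_frameZero_le_bell4 [NeZero L] [NeZero M] {β : ℝ} (hβ : 0 < β) {μ : ℝ} (hμ : μ ∈ klWindowC) (c : ℂ)
    {Mdeg : ℕ} (hM : 8 ≤ Mdeg)
    (hγ : ContDiff ℝ 4 fun θ : ℝ => (WithLp.toLp 2 (klFermiPoint μ 0 θ) : Momentum)) {D : ℕ → ℝ}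
    (hD : ∀ θ : ℝ, ∀ i, 1 ≤ i → i ≤ 4 → ‖iteratedDeriv i (fun θ : ℝ => (WithLp.toLp 2 (klFermiPoint μ 0 θ) : Momentum)) θ‖ ≤ D i)
    {A : ℕ → ℝ}
    (hA : ∀ j ≤ 4, 2 * ((3 : ℝ) ^ j *
      (‖(-c * ((((2 * (2 * M) : ℕ) : ℂ) ^ 2 / (β ^ 3 * (L : ℝ) ^ 2 : ℝ)) : ℂ))‖ *
        (8 * (|β * (L : ℝ) ^ 2| * (2 / klE0)) * ((Mdeg ! : ℝ)) ^ 2 * (4 * 4 * (1 + 2 * (16 * (1 + 342) / klE0))) ^ Mdeg)) *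
      (2 / ((2 * (L / 4 + 1) : ℕ) : ℝ)) ^ (Mdeg - j - 4) * (2 ^ 2 * ∑' k : Fin 2 → ℤ, ∏ i, (1 + (k i : ℝ) ^ 2)⁻¹)) ≤ A j) (θ : ℝ) :
    |evalM (symInterp L (fun k : TorusSite 2 L =>
        (∑ σ : Fin 2, ((selfEnergy L M β (ExteriorAlgebra.map (Matrix.toLin' (hubbardGridSub L M β (2 * (2 * M))))
          (∑ p : GridPoint L (2 * (2 * M)), ∑ q : GridPoint L (2 * (2 * M)), ∑ σ' : Fin 2,
            (c * contr ℂ ((hubbardGridSub L M β (2 * (2 * M))).transpose * hubbardCovAboveCT L M β μ 0 0 klE0 *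
                hubbardGridSub L M β (2 * (2 * M))) (((q, σ'), 0) : GridLeg (GridPoint L (2 * (2 * M)))) ((p, σ'), 1)) •
              (gen ℂ (((p, σ'), 0) : GridLeg (GridPoint L (2 * (2 * M)))) * gen ℂ (((q, σ'), 1) : GridLeg (GridPoint L (2 * (2 * M)))))))
            (omega0 M, k) σ).re +
        (selfEnergy L M β (ExteriorAlgebra.map (Matrix.toLin' (hubbardGridSub L M β (2 * (2 * M))))
          (∑ p : GridPoint L (2 * (2 * M)), ∑ q : GridPoint L (2 * (2 * M)), ∑ σ' : Fin 2,
            (c * contr ℂ ((hubbardGridSub L M β (2 * (2 * M))).transpose * hubbardCovAboveCT L M β μ 0 0 klE0 *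
                hubbardGridSub L M β (2 * (2 * M))) (((q, σ'), 0) : GridLeg (GridPoint L (2 * (2 * M)))) ((p, σ'), 1)) •
              (gen ℂ (((p, σ'), 0) : GridLeg (GridPoint L (2 * (2 * M)))) * gen ℂ (((q, σ'), 1) : GridLeg (GridPoint L (2 * (2 * M)))))))
            ((omega0 M).rev, k) σ).re)) / 4)) (WithLp.toLp 2 (klFermiPoint μ 0 θ))| ≤ A 0 ∧
    ∀ k, 1 ≤ k → k ≤ 4 →
      |iteratedDeriv k (fun θ : ℝ => evalM (symInterp L (fun k : TorusSite 2 L =>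
        (∑ σ : Fin 2, ((selfEnergy L M β (ExteriorAlgebra.map (Matrix.toLin' (hubbardGridSub L M β (2 * (2 * M))))
          (∑ p : GridPoint L (2 * (2 * M)), ∑ q : GridPoint L (2 * (2 * M)), ∑ σ' : Fin 2,
            (c * contr ℂ ((hubbardGridSub L M β (2 * (2 * M))).transpose * hubbardCovAboveCT L M β μ 0 0 klE0 *
                hubbardGridSub L M β (2 * (2 * M))) (((q, σ'), 0) : GridLeg (GridPoint L (2 * (2 * M)))) ((p, σ'), 1)) •
              (gen ℂ (((p, σ'), 0) : GridLeg (GridPoint L (2 * (2 * M)))) * gen ℂ (((q, σ'), 1) : GridLeg (GridPoint L (2 * (2 * M)))))))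
            (omega0 M, k) σ).re +
        (selfEnergy L M β (ExteriorAlgebra.map (Matrix.toLin' (hubbardGridSub L M β (2 * (2 * M))))
          (∑ p : GridPoint L (2 * (2 * M)), ∑ q : GridPoint L (2 * (2 * M)), ∑ σ' : Fin 2,
            (c * contr ℂ ((hubbardGridSub L M β (2 * (2 * M))).transpose * hubbardCovAboveCT L M β μ 0 0 klE0 *
                hubbardGridSub L M β (2 * (2 * M))) (((q, σ'), 0) : GridLeg (GridPoint L (2 * (2 * M)))) ((p, σ'), 1)) •
              (gen ℂ (((p, σ'), 0) : GridLeg (GridPoint L (2 * (2 * M)))) * gen ℂ (((q, σ'), 1) : GridLeg (GridPoint L (2 * (2 * M)))))))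
            ((omega0 M).rev, k) σ).re)) / 4)) (WithLp.toLp 2 (klFermiPoint μ 0 θ))) θ| ≤ bell4 A D k := by
  have hω₁ : π / β ≠ 0 := by positivity
  have hω₂ : -(π / β) ≠ 0 := neg_ne_zero.mpr hω₁
  rw [locSymbol_map_gridSub_chainQuadratic_eq_sample (L := L) (M := M) hβ μ c]
  exact abs_curveJets_evalM_symInterp_le_bell4_of_vanish (L := L)
    (chainSymbolFn_periodic _ _ _ _ _ μ) (contDiff_chainSymbolFn _ _ _ hω₁ hω₂ μ) (chainSymbolFn_reflect _ _ _ _ _ μ)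
    (chainSymbolFn_swap _ _ _ _ _ μ) hM (fun q => norm_iteratedFDeriv_chainSymbolFn_le _ _ hω₁ hω₂ μ Mdeg q)
    (γ := fun θ : ℝ => (WithLp.toLp 2 (klFermiPoint μ 0 θ) : Momentum)) hγ hD (fun θ => chainSymbolFn_klFermiPoint _ _ β hμ θ) hA θ

end Summit.HubbardSuperconductivity.HubbardSuperconductivity.Theorems.EngineV8

end
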